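import Summits.MatrixMultiplication.OmegaCensus.STPP211TFirstReflectB
import Summits.MatrixMultiplication.OmegaCensus.STPPSmallPatternKernelReflect

/-!
# ω-census, `(2,1,1)^k` T-first kernel engine — reflection C: the placement search never refutes a solution

HONEST FRAMING (pub-omega census; verbatim): lottery ticket; floor = certified bounds/negative ranges.
Census STRUCTURE bookkeeping of the STPP track (seat pub-omega-stpp-1, gen 38; STRUCTURE row B5, the threshold column
`T1(H) = max {k : (2,1,1)^k ⊆ H}`), not progress on `ω`: small patterns in small groups bound no exponent.

Third reflection file for `STPP211TFirstEngine.lean`.  Fix a solution `p q cz : Fin K → ZMod n` of the difference model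
`ModelD` (`STPPSmallPatternKernelInvariant.lean`) whose classes are numbered like the kernel's (`codeAt OC l = (cz l).val`)
and whose pairs are oriented (`(p l).val < (q l).val`).  §6 KILL SOUNDNESS: the kill pattern of the placement of `x₀ ∈ A_l`
never clears the code of another member `x ∈ A_{l'}` of the solution (a cleared bit names `x − x₀` as `cⱼ − c_l` or
`c_{l'} − cⱼ`, against `ModelD`).  §7 THE INVARIANT `Inv`: sentinels set, `S1`/`S2` = the classes owing one / two members,
the codes of the members still owed are set.  §8 `psearch … = false` along the solution (induction on the fuel; the two
death tests are confirmed on a lane that still holds an owed code, the chosen lane is open, and the child keeping the owed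
member of that lane satisfies `Inv` again).  §9 the LEAF: the first placement `p₀ = 0`, `q₀ ∈ [1, n/2]`.

References: H. Cohn, R. Kleinberg, B. Szegedy, C. Umans, *Group-theoretic algorithms for matrix multiplication*, FOCS 2005
(arXiv:math/0511460), Def. 5.1.  Desk record: pub-omega HOME `pub-omega-stpp-1-g38/`.
-/

namespace Summit.MatrixMultiplication.OmegaCensus

namespace STPP211T

open STPP211Neg
open Literature.Computability.Complexity (div_mod_block)
open Summit.MatrixMultiplication.OmegaCensus.T1Z2p5 (testBit_lowMask)
open Literature.Barriers.RiemannHypothesis.TuranCheck (beq_true_iff)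

section Positions

variable {n : ℕ}

/-- The sentinel bit of lane `l`. -/
def sbit (n l : ℕ) : ℕ := 2 ^ (64 + l * (2 * n) + n)

/-- Position of bit `y` of lane `l`. -/
def posn (n l y : ℕ) : ℕ := 64 + l * (2 * n) + y

/-- `posn` unfolded. -/
theorem posn_eq (l y : ℕ) : posn n l y = 64 + l * (2 * n) + y := rfl

/-- Positions are injective (for in-lane offsets `< 2n`). -/
theorem posn_inj {l l' y y' : ℕ} (hy : y < 2 * n) (hy' : y' < 2 * n) (h : posn n l y = posn n l' y') :
    l = l' ∧ y = y' := by
  unfold posn at h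
  have h1 := div_mod_block (k := l) hy
  have h2 := div_mod_block (k := l') hy'
  have he : l * (2 * n) + y = l' * (2 * n) + y' := by omega
  rw [he] at h1
  exact ⟨h1.1.symm.trans h2.1, h1.2.symm.trans h2.2⟩

/-- `sbit n l = 2 ^ posn n l n`. -/ theorem sbit_eq (l : ℕ) : sbit n l = 2 ^ posn n l n := rfl

end Positions

section SPhase

variable {n K : ℕ} [NeZero n] (units : List ℕ) {L : List ℕ} {OC : ℕ} {p q cz : Fin K → ZMod n}

/-- The pattern word of the leaf: all kill patterns `epAll` of the code list `L` in the class order `OC`. -/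
noncomputable def EPT (n K : ℕ) (units L : List ℕ) (OC : ℕ) : ℕ :=
  epAll (mkTC n K units) (maskL L) (negMask (mkTC n K units) L) OC

/-- `EPup = (EP <<< upK) ||| PM`. -/
noncomputable def EPupT (n K : ℕ) (units L : List ℕ) (OC : ℕ) : ℕ :=
  Nat.lor (Nat.shiftLeft (EPT n K units L OC) (mkTC n K units).upK) (maskL L)

/-- The (aligned) patterns of class `l`, as extracted by `pnode`. -/
noncomputable def EPlT (n K : ℕ) (units L : List ℕ) (OC l : ℕ) : ℕ :=
  Nat.shiftLeft (Nat.land (Nat.div (EPupT n K units L OC) (Nat.pow (sbit n l) (mkTC n K units).K))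
    (mkTC n K units).allKW) 64

/-- The kill pattern of placing code `a` in class `l`. -/
noncomputable def killT (n K : ℕ) (units L : List ℕ) (OC l a : ℕ) : ℕ :=
  Nat.land (Nat.shiftRight (Nat.mul (EPlT n K units L OC l) (2 ^ a)) (mkTC n K units).n) (mkTC n K units).lown

/-! ## 6. Kill soundness -/

/-- Codes: `((x − x₀).val)` as the engine computes it. -/
theorem val_sub_eq (x x0 : ZMod n) : (x - x0).val = (x.val + (n - x0.val)) % n :=
  ((zmodEnc n).sub_enc x x0).symm

/-- HYPOTHESES ON THE LEAF DATA: every listed code is the code of some class, every class code is listed, and the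
class order lists the classes' codes (`codeAt OC l = (cz l).val`). -/
def LeafData (n K : ℕ) [NeZero n] (L : List ℕ) (OC : ℕ) (cz : Fin K → ZMod n) : Prop :=
  (∀ e ∈ L, ∃ j : Fin K, e = (cz j).val) ∧ (∀ j : Fin K, (cz j).val ∈ L) ∧ (∀ l : Fin K, codeAt OC l.val = (cz l).val)

/-- Projection `memL` of `LeafData`. -/
theorem LeafData.memL (hD : LeafData n K L OC cz) : ∀ e ∈ L, ∃ j : Fin K, e = (cz j).val := hD.1
/-- Projection `covL` of `LeafData`. -/
theorem LeafData.covL (hD : LeafData n K L OC cz) : ∀ j : Fin K, (cz j).val ∈ L := hD.2.1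
/-- Projection `ord` of `LeafData`. -/
theorem LeafData.ord (hD : LeafData n K L OC cz) : ∀ l : Fin K, codeAt OC l.val = (cz l).val := hD.2.2

/-- Listed codes are `< n`. -/
theorem LeafData.ltL (hD : LeafData n K L OC cz) : ∀ e ∈ L, e < n := by
  intro e he; obtain ⟨j, rfl⟩ := hD.memL e he; exact ZMod.val_lt _

/-- **KILL SOUNDNESS.** Placing `x₀ ∈ A_l` never clears the code of another member `x ∈ A_{l'}` of the solution. -/
theorem kill_false (hn : 1 ≤ n) (hK : 1 ≤ K) (hM : ModelD p q cz) (hD : LeafData n K L OC cz) {l l' : Fin K}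
    {x0 x : ZMod n} (hx0 : InA p q l x0) (hx : InA p q l' x) (hne : x ≠ x0) :
    (killT n K units L OC l.val x0.val).testBit (64 + l'.val * (2 * n) + x.val) = false := by
  by_contra h
  rw [Bool.not_eq_false] at h
  have hxn : x.val < n := ZMod.val_lt x
  have hx0n : x0.val < n := ZMod.val_lt x0
  unfold killT at h
  rw [testBit_kill units _ _ (le_of_lt hx0n) l'.isLt (by omega), decide_eq_true hxn, Bool.true_and] at h
  have hj' : x.val + n - x0.val < 2 * n := by omega
  unfold EPlT EPupT sbit at h
  rw [show 64 + l'.val * (2 * n) + (x.val + n - x0.val) = 64 + (l'.val * (2 * n) + (x.val + n - x0.val)) by omega,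
    testBit_extract units hK _ _ (maskL_lt L hD.ltL), decide_eq_true (lane_lt l'.isLt hj'), Bool.true_and] at h
  unfold EPT at h
  rw [testBit_epAll units hn _ _ _ l.isLt l'.isLt hj'] at h
  -- the entry bit names d = (x - x0).val
  set d := (if x.val + n - x0.val < n then x.val + n - x0.val else x.val + n - x0.val - n) with hd
  have hdval : d = (x - x0).val := by
    rw [val_sub_eq, hd]
    by_cases hc : x.val + n - x0.val < n
    · rw [if_pos hc, Nat.mod_eq_of_lt (by omega)]; omega
    · rw [if_neg hc, show x.val + (n - x0.val) = (x.val + n - x0.val - n) + n by omega, Nat.add_mod_right,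
        Nat.mod_eq_of_lt (by omega)]
  have hdn : d < n := by rw [hdval]; exact ZMod.val_lt _
  have hcode_l : codeAt OC l.val < n := by rw [hD.ord l]; exact ZMod.val_lt _
  have hcode_l' : codeAt OC l'.val < n := by rw [hD.ord l']; exact ZMod.val_lt _
  rcases entry_sound units (maskL_lt L hD.ltL) (negMask_lt units hn L) hcode_l hcode_l' hdn h with h0 | h1 | h2
  · -- d = 0: x = x0
    rw [hdval] at h0
    exact hne (sub_eq_zero.1 ((ZMod.val_eq_zero _).1 h0))
  · -- d ∈ T − c_l
    rw [testBit_maskL] at h1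
    have h1' := of_decide_eq_true h1
    obtain ⟨j, hj⟩ := hD.memL _ h1'
    rw [hD.ord l, hdval, ← ZMod.val_add] at hj
    have hj2 : x - x0 + cz l = cz j := ZMod.val_injective n hj
    have hjl : j ≠ l := by
      rintro rfl; apply hne; have : x - x0 = 0 := by simpa using hj2
      exact sub_eq_zero.1 this
    exact hM.2.2 l' j l x x0 hjl hx hx0 (eq_sub_of_add_eq hj2)
  · -- d ∈ c_{l'} − T
    obtain ⟨t, ht, hte⟩ := negMask_sound _ L h2
    obtain ⟨j, rfl⟩ := hD.memL t ht
    rw [mkTC_n, hD.ord l', hdval, ← val_sub_eq, show (n - (cz j).val) % n = ((0 : ZMod n) - cz j).val by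
      rw [val_sub_eq, ZMod.val_zero, Nat.zero_add]] at hte
    have hj2 : x - x0 - cz l' = 0 - cz j := ZMod.val_injective n hte
    have hjl : j ≠ l' := by
      rintro rfl; apply hne
      have : x - x0 = 0 := by
        have := hj2; rw [zero_sub, sub_eq_iff_eq_add] at this; simpa using this
      exact sub_eq_zero.1 this
    refine hM.2.2 l j l' x0 x hjl hx0 hx ?_
    have : x - x0 = cz l' - cz j := by rw [zero_sub, sub_eq_iff_eq_add] at hj2; rw [hj2]; abel
    rw [← neg_sub x x0, this, neg_sub]

/-! ## 7. The invariant of the placement search -/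

/-- THE INVARIANT of a search state `(M, S1, S2)` against the solution: `O1`/`O2` = classes owing one/two members
(disjoint), `S1`/`S2` = exactly their sentinel bits, every sentinel of `M` is set, and the codes of the owed members are
set (`q_l` for `l ∈ O1`; `p_l, q_l` for `l ∈ O2`).  Bits below `64` (the salt) and all other bits are unconstrained. -/
def Inv (n K : ℕ) [NeZero n] (p q : Fin K → ZMod n) (O1 O2 : Finset (Fin K)) (M S1 S2 : ℕ) : Prop :=
  Disjoint O1 O2 ∧
  (∀ i, S1.testBit i = true ↔ ∃ l ∈ O1, i = posn n l.val n) ∧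
  (∀ i, S2.testBit i = true ↔ ∃ l ∈ O2, i = posn n l.val n) ∧
  (∀ l : Fin K, M.testBit (posn n l.val n) = true) ∧
  (∀ l ∈ O2, M.testBit (posn n l.val (p l).val) = true ∧ M.testBit (posn n l.val (q l).val) = true) ∧
  (∀ l ∈ O1, M.testBit (posn n l.val (q l).val) = true)

/-- `xor` with zero result means equal. -/
theorem eq_of_xor_eq_zero {a b : ℕ} (h : Nat.xor a b = 0) : a = b := by
  apply Nat.eq_of_testBit_eq; intro i
  have := congrArg (fun x => Nat.testBit x i) h
  simp only [xor_eq, Nat.testBit_xor, Nat.zero_testBit] at this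
  revert this; cases a.testBit i <;> cases b.testBit i <;> simp

/-- From a flagged sub-word `A = T &&& S ≠ S` of a sentinel word `S`: the lowest flagged bit is a sentinel of `S`. -/
theorem flagged_bit {T S : ℕ} (h : Nat.beq (Nat.land T S) S = false) :
    ∃ i, S.testBit i = true ∧ lowBit (Nat.xor S (Nat.land T S)) = 2 ^ i := by
  have hne : Nat.land T S ≠ S := fun e => by rw [e, Nat.beq_refl] at h; exact Bool.noConfusion h
  have hw : Nat.xor S (Nat.land T S) ≠ 0 := fun e => hne (eq_of_xor_eq_zero e).symm
  obtain ⟨i, hi, hL⟩ := lowBit_eq_two_pow hw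
  refine ⟨i, ?_, hL⟩
  rw [xor_eq, land_eq, Nat.testBit_xor, Nat.testBit_land] at hi
  revert hi; cases S.testBit i <;> cases T.testBit i <;> simp

/-- A word with two distinct set bits keeps a set bit after clearing its lowest one. -/
theorem land_pred_ne_zero {v a b : ℕ} (ha : v.testBit a = true) (hb : v.testBit b = true) (hab : a ≠ b) :
    Nat.beq (Nat.land v (Nat.sub v 1)) 0 = false := by
  have hv : v ≠ 0 := ne_zero_of_testBit ha
  obtain ⟨i0, -, hbits⟩ := testBit_land_pred hv
  apply IcosetW.beq_false_of_ne
  rw [land_eq, sub_eq']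
  by_cases hai : a = i0
  · have : (v &&& (v - 1)).testBit b = true := by rw [hbits b, hb]; simp; omega
    exact ne_zero_of_testBit this
  · have : (v &&& (v - 1)).testBit a = true := by rw [hbits a, ha]; simp [hai]
    exact ne_zero_of_testBit this

section Search

/-- DEATH TEST 1 never fires along the solution. -/
theorem dead1_false {O1 O2 : Finset (Fin K)} {M S1 S2 : ℕ} (hI : Inv n K p q O1 O2 M S1 S2) (T : ℕ) :
    (!(Nat.beq (Nat.land T S1) S1) &&
      Nat.beq (laneVal (mkTC n K units) M (lowBit (Nat.xor S1 (Nat.land T S1)))) 0) = false := by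
  cases h : Nat.beq (Nat.land T S1) S1
  · obtain ⟨i, hi, hL⟩ := flagged_bit h
    obtain ⟨l, hl, rfl⟩ := (hI.2.1 i).1 hi
    rw [hL, posn_eq, Bool.not_false, Bool.true_and]
    apply IcosetW.beq_false_of_ne
    apply ne_zero_of_testBit (x := (q l).val)
    rw [testBit_laneVal, decide_eq_true (ZMod.val_lt _), Bool.true_and]
    exact hI.2.2.2.2.2 l hl
  · rfl

/-- DEATH TEST 2 never fires along the solution. -/
theorem dead2_false (hM : ModelD p q cz) {O1 O2 : Finset (Fin K)} {M S1 S2 : ℕ} (hI : Inv n K p q O1 O2 M S1 S2)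
    (T : ℕ) :
    (!(Nat.beq (Nat.land T S2) S2) &&
      Nat.beq (Nat.land (laneVal (mkTC n K units) M (lowBit (Nat.xor S2 (Nat.land T S2))))
        (Nat.sub (laneVal (mkTC n K units) M (lowBit (Nat.xor S2 (Nat.land T S2)))) 1)) 0) = false := by
  cases h : Nat.beq (Nat.land T S2) S2
  · obtain ⟨i, hi, hL⟩ := flagged_bit h
    obtain ⟨l, hl, rfl⟩ := (hI.2.2.1 i).1 hi
    rw [hL, posn_eq, Bool.not_false, Bool.true_and]
    have hp := (hI.2.2.2.2.1 l hl).1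
    have hq := (hI.2.2.2.2.1 l hl).2
    have hpq : (p l).val ≠ (q l).val := fun e => hM.1 l (ZMod.val_injective n e)
    apply land_pred_ne_zero (a := (p l).val) (b := (q l).val) _ _ hpq
    · rw [testBit_laneVal, decide_eq_true (ZMod.val_lt _), Bool.true_and]; exact hp
    · rw [testBit_laneVal, decide_eq_true (ZMod.val_lt _), Bool.true_and]; exact hq
  · rfl

omit [NeZero n] in
/-- Sentinels survive an update by a kill pattern (and a cut). -/
theorem sent_update (hn : 1 ≤ n) (M : ℕ) (l : Fin K) (a tg : ℕ) (l'' : Fin K)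
    (hs : M.testBit (posn n l''.val n) = true) :
    (Nat.xor (Nat.land M (Nat.xor (mkTC n K units).call (killT n K units L OC l.val a))) (psalt (2 ^ a) tg)).testBit
      (posn n l''.val n) = true := by
  rw [posn_eq] at hs ⊢
  rw [testBit_update units (by rw [testBit_call units l''.isLt (by omega)]; simp) (by omega), hs, Bool.true_and]
  unfold killT
  rw [testBit_kill_off units _ _ _ (Or.inr ⟨l''.val, n, by omega, rfl, Or.inl le_rfl⟩)]; rfl

omit [NeZero n] in
/-- Sentinels survive the update of a first placement (kill pattern and cut). -/
theorem sent_update2 (M : ℕ) (l : Fin K) {a : ℕ} (ha : a < n) (tg : ℕ) (l'' : Fin K)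
    (hs : M.testBit (posn n l''.val n) = true) :
    (Nat.xor (Nat.land (Nat.land M (Nat.xor (mkTC n K units).call (killT n K units L OC l.val a)))
      (Nat.xor (mkTC n K units).call (Nat.mul (Nat.sub (Nat.add (2 ^ a) (2 ^ a)) 1)
        (Nat.shiftRight (sbit n l.val) (mkTC n K units).n)))) (psalt (2 ^ a) tg)).testBit (posn n l''.val n) = true := by
  rw [posn_eq] at hs ⊢
  rw [testBit_update2 units (by rw [testBit_call units l''.isLt (by omega)]; simp) (by omega), hs, Bool.true_and]
  unfold killT sbit
  rw [testBit_kill_off units _ _ _ (Or.inr ⟨l''.val, n, by omega, rfl, Or.inl le_rfl⟩), testBit_cut units ha (by omega)]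
  simp; omega

/-- An owed code survives the update of another placement of the solution. -/
theorem owed_update (hn : 1 ≤ n) (hK : 1 ≤ K) (hM : ModelD p q cz) (hD : LeafData n K L OC cz) (M : ℕ) {l l' : Fin K}
    {x0 x : ZMod n} (hx0 : InA p q l x0) (hx : InA p q l' x) (hne : x ≠ x0) (tg : ℕ)
    (hs : M.testBit (posn n l'.val x.val) = true) :
    (Nat.xor (Nat.land M (Nat.xor (mkTC n K units).call (killT n K units L OC l.val x0.val))) (psalt (2 ^ x0.val) tg)).testBit
      (posn n l'.val x.val) = true := by
  have hxn : x.val < n := ZMod.val_lt x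
  rw [posn_eq] at hs ⊢
  rw [testBit_update units (by rw [testBit_call units l'.isLt (by omega)]; simp; omega) (by omega), hs, Bool.true_and,
    kill_false units hn hK hM hD hx0 hx hne]; rfl

/-- An owed code survives the update of a first placement of the solution (kill pattern and cut). -/
theorem owed_update2 (hn : 1 ≤ n) (hK : 1 ≤ K) (hM : ModelD p q cz) (hD : LeafData n K L OC cz) (M : ℕ) {l l' : Fin K}
    {x0 x : ZMod n} (hx0 : InA p q l x0) (hx : InA p q l' x) (hne : x ≠ x0) (hcut : ¬ (l'.val = l.val ∧ x.val ≤ x0.val))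
    (tg : ℕ) (hs : M.testBit (posn n l'.val x.val) = true) :
    (Nat.xor (Nat.land (Nat.land M (Nat.xor (mkTC n K units).call (killT n K units L OC l.val x0.val)))
      (Nat.xor (mkTC n K units).call (Nat.mul (Nat.sub (Nat.add (2 ^ x0.val) (2 ^ x0.val)) 1)
        (Nat.shiftRight (sbit n l.val) (mkTC n K units).n)))) (psalt (2 ^ x0.val) tg)).testBit (posn n l'.val x.val) = true := by
  have hxn : x.val < n := ZMod.val_lt x
  rw [posn_eq] at hs ⊢
  rw [testBit_update2 units (by rw [testBit_call units l'.isLt (by omega)]; simp; omega) (by omega), hs,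
    Bool.true_and, kill_false units hn hK hM hD hx0 hx hne]
  unfold sbit
  rw [testBit_cut units (ZMod.val_lt x0) (by omega)]
  simp [hcut]

omit [NeZero n] in
/-- Members of different classes differ. -/
theorem ne_of_classes (hM : ModelD p q cz) {l l' : Fin K} (hll : l ≠ l') {x0 x : ZMod n} (hx0 : InA p q l x0)
    (hx : InA p q l' x) : x ≠ x0 := by
  rintro rfl; exact hM.2.1 l l' x hll hx0 hx

omit [NeZero n] in
/-- The sentinel word after `xor` with one sentinel bit. -/
theorem sent_xor (hn : 1 ≤ n) {S : ℕ} {O : Finset (Fin K)} (hS : ∀ i, S.testBit i = true ↔ ∃ l ∈ O, i = posn n l.val n)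
    (l : Fin K)
    (O' : Finset (Fin K)) (hO' : ∀ l2, l2 ∈ O' ↔ (l2 ∈ O ↔ l2 ≠ l)) :
    ∀ i, (Nat.xor S (sbit n l.val)).testBit i = true ↔ ∃ l2 ∈ O', i = posn n l2.val n := by
  intro i
  rw [sbit_eq, xor_eq, Nat.testBit_xor, Nat.testBit_two_pow]
  by_cases hi : posn n l.val n = i
  · subst hi
    simp only [decide_true, Bool.xor_true, Bool.not_eq_true']
    constructor
    · intro h
      have hl : l ∉ O := fun hl => by have := (hS _).2 ⟨l, hl, rfl⟩; rw [this] at h; exact Bool.noConfusion h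
      exact ⟨l, (hO' l).2 ⟨fun h => absurd h hl, fun h => absurd rfl h⟩, rfl⟩
    · rintro ⟨l2, hl2, he⟩
      have := (posn_inj (by omega) (by omega) he).1
      have hl2l : l2 = l := Fin.ext this.symm
      subst hl2l
      cases hb : S.testBit (posn n l2.val n)
      · rfl
      · exact absurd ((hO' l2).1 hl2 |>.1 (((hS _).1 hb).elim fun l3 ⟨hl3, he3⟩ => by
          have := Fin.ext (posn_inj (n := n) (by omega) (by omega) he3).1; subst this; exact hl3)) (fun h => h rfl)
  · have : decide (posn n l.val n = i) = false := by simp [hi]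
    rw [this, Bool.xor_false, hS]
    constructor
    · rintro ⟨l2, hl2, rfl⟩
      exact ⟨l2, (hO' l2).2 ⟨fun _ => fun e => hi (by rw [e]), fun _ => hl2⟩, rfl⟩
    · rintro ⟨l2, hl2, rfl⟩
      have hne : l2 ≠ l := fun e => hi (by rw [e])
      exact ⟨l2, ((hO' l2).1 hl2).2 hne, rfl⟩

end Search

end SPhase

end STPP211T

end Summit.MatrixMultiplication.OmegaCensus
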